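import Summits.BirchSwinnertonDyer.BirchSwinnertonDyer.Theorems.Rank2Observatory2DescKillSig3
import HarnessLib

/-!
# KERNEL-2DESC — the 2-ADIC signature certificate for ONE `ℤ₂`-root + a QUADRATIC place (`KillSig2X`), PART 1 of 5:
# pair arithmetic `O_w/2^N = (ℤ/2^N)[w]/(w² − s₁w − s₀)`, the kill relation and the UNRAMIFIED core lemma + leaf
# (rank-2 observatory, cert-1 gen 39/40; design `b2b-bsdr2-cert-1/…/generics/sig2x/README-SIG2X.md`, census `census/sig2x/`)

HONEST FRAMING: per-curve certified theorems and census instruments; no claim on BSD in rank ≥ 2.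
PARTITION: none — rank ≥ 2 data (N3); no r ≤ 1 cell claimed.

When the field cubic `g = X³ + aX² + bX + c` has exactly one `ℤ₂`-root `ε`, the other place of `K = ℚ(α)` over `2`
is the quadratic field `K_w = ℚ₂(w)`, `w² = s₁w + s₀` (`s₀, s₁` odd: unramified; `v₂(s₀) = 1, 2 ∣ s₁`: ramified,
`w` a uniformiser), and `α ↦ A = p + q·w`.  Everything is INTEGER PAIR arithmetic: `(b₀, b₁)` stands for
`b₀ + b₁w`; `qmul` is the product reduced with `w² = s₁w + s₀`; `pev A u` the value of `u₀ + u₁α + u₂α²` at `A`;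
`pg A` the value of `g` at `A`.  The identities `pev (mul3 u v) = qmul (pev u) (pev v) + qmul κ (pg A)` are
polynomial identities (the coordinates on `{1, w}` of the corresponding identity in `ℤ[vars][w]/(w² − s₁w − s₀)`,
cf. `ev_mul3`), so a certificate that checks `pg A ≡ (0, 0) (mod 2^N)` obtains the kill relation
`Z·R² ≡ w₀ − n²·T(A) (mod 2^N)` coordinate-wise (`root_rel₂`) for ANY such pair `A` — soundness never needs that
`A` is 'the' root.  No instances, no `native_decide`, sorry-free.
[cite: Cassels1991LecturesEllipticCurves, §15] [cite: CremonaAlgorithms1997, §3.6]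
-/

-- single-conjunct summit: `Summit.BirchSwinnertonDyer.BirchSwinnertonDyer.…` repeats the name by design
set_option linter.dupNamespace false

namespace Summit.BirchSwinnertonDyer.BirchSwinnertonDyer.Rank2Observatory.TwoDescKill
/-! ### Pair arithmetic on `{1, w}`, `w² = s₁w + s₀` -/

/-- `(x₀ + x₁w)(y₀ + y₁w)` on `{1, w}` using `w² = s₁w + s₀` (named `qmul`: `TwoDescKill.pmul` is the `ℤ[√d]` product of `…KillSig12Defs`). [folklore] -/
def qmul (s₁ s₀ : ℤ) (x y : ℤ × ℤ) : ℤ × ℤ :=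
  (x.1 * y.1 + x.2 * y.2 * s₀, x.1 * y.2 + x.2 * y.1 + x.2 * y.2 * s₁)

/-- `x + y` on `{1, w}`. [folklore] -/
def padd (x y : ℤ × ℤ) : ℤ × ℤ := (x.1 + y.1, x.2 + y.2)

/-- `k • x` on `{1, w}`. [folklore] -/
def psc (k : ℤ) (x : ℤ × ℤ) : ℤ × ℤ := (k * x.1, k * x.2)

/-- The value `u₀ + u₁A + u₂A²` of a coordinate vector at the pair `A`. [folklore] -/
def pev (s₁ s₀ : ℤ) (A : ℤ × ℤ) (u : ℤ × ℤ × ℤ) : ℤ × ℤ :=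
  padd (padd (u.1, 0) (psc u.2.1 A)) (psc u.2.2 (qmul s₁ s₀ A A))

/-- The value `g(A) = A³ + aA² + bA + c` at the pair `A`. [folklore] -/
def pg (s₁ s₀ a b c : ℤ) (A : ℤ × ℤ) : ℤ × ℤ :=
  padd (qmul s₁ s₀ (qmul s₁ s₀ A A) A) (padd (psc a (qmul s₁ s₀ A A)) (padd (psc b A) (c, 0)))

/-- `qmul` is commutative. [folklore] -/
theorem qmul_comm (s₁ s₀ : ℤ) (x y : ℤ × ℤ) : qmul s₁ s₀ x y = qmul s₁ s₀ y x := by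
  simp only [qmul]; ext <;> ring

/-- `qmul` is associative. [folklore] -/
theorem qmul_assoc (s₁ s₀ : ℤ) (x y t : ℤ × ℤ) :
    qmul s₁ s₀ (qmul s₁ s₀ x y) t = qmul s₁ s₀ x (qmul s₁ s₀ y t) := by
  simp only [qmul]; ext <;> ring

/-- **`mul3` is multiplication at the quadratic place, up to a multiple of `g(A)`**: the cofactor is
`κ = −(u₁v₂ + u₂v₁) − u₂v₂·(A − a)` as in `ev_mul3`. [folklore] -/
theorem pev_mul3 (s₁ s₀ a b c : ℤ) (A : ℤ × ℤ) (u v : ℤ × ℤ × ℤ) :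
    pev s₁ s₀ A (mul3 a b c u v) =
      padd (qmul s₁ s₀ (pev s₁ s₀ A u) (pev s₁ s₀ A v))
        (qmul s₁ s₀ (padd (-(u.2.1 * v.2.2 + u.2.2 * v.2.1) + u.2.2 * v.2.2 * a, 0) (psc (-(u.2.2 * v.2.2)) A))
          (pg s₁ s₀ a b c A)) := by
  simp only [pev, qmul, padd, psc, pg, mul3]
  ext <;> ring

/-- `qmul` distributes over `padd` (right). [folklore] -/
theorem qmul_padd (s₁ s₀ : ℤ) (x y t : ℤ × ℤ) :
    qmul s₁ s₀ x (padd y t) = padd (qmul s₁ s₀ x y) (qmul s₁ s₀ x t) := by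
  simp only [qmul, padd]; ext <;> ring

/-- `qmul` distributes over `padd` (left). [folklore] -/
theorem padd_qmul (s₁ s₀ : ℤ) (x y t : ℤ × ℤ) :
    qmul s₁ s₀ (padd x y) t = padd (qmul s₁ s₀ x t) (qmul s₁ s₀ y t) := by
  simp only [qmul, padd]; ext <;> ring

/-- A multiple of a pair divisible by `m` coordinate-wise is divisible by `m` coordinate-wise. [folklore] -/
theorem dvd_qmul {m s₁ s₀ : ℤ} (κ : ℤ × ℤ) {G : ℤ × ℤ} (h₁ : m ∣ G.1) (h₂ : m ∣ G.2) :
    m ∣ (qmul s₁ s₀ κ G).1 ∧ m ∣ (qmul s₁ s₀ κ G).2 := by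
  obtain ⟨k₁, hk₁⟩ := h₁
  obtain ⟨k₂, hk₂⟩ := h₂
  refine ⟨⟨κ.1 * k₁ + κ.2 * k₂ * s₀, ?_⟩, ⟨κ.1 * k₂ + κ.2 * k₁ + κ.2 * k₂ * s₁, ?_⟩⟩
  · simp only [qmul]; rw [hk₁, hk₂]; ring
  · simp only [qmul]; rw [hk₁, hk₂]; ring

/-- **`zsq` at the quadratic place**: `(z·r²)(A) = Z·R² + κ·g(A)` for an explicit pair `κ`. [folklore] -/
theorem pev_zsq (s₁ s₀ a b c : ℤ) (A : ℤ × ℤ) (z r : ℤ × ℤ × ℤ) :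
    ∃ κ : ℤ × ℤ, pev s₁ s₀ A (zsq a b c z r) =
      padd (qmul s₁ s₀ (pev s₁ s₀ A z) (qmul s₁ s₀ (pev s₁ s₀ A r) (pev s₁ s₀ A r))) (qmul s₁ s₀ κ (pg s₁ s₀ a b c A)) := by
  simp only [zsq, pev_mul3]
  exact ⟨padd (qmul s₁ s₀ (pev s₁ s₀ A z) (padd (-(r.2.1 * r.2.2 + r.2.2 * r.2.1) + r.2.2 * r.2.2 * a, 0) (psc (-(r.2.2 * r.2.2)) A)))
      (padd (-(z.2.1 * (mul3 a b c r r).2.2 + z.2.2 * (mul3 a b c r r).2.1) + z.2.2 * (mul3 a b c r r).2.2 * a, 0)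
        (psc (-(z.2.2 * (mul3 a b c r r).2.2)) A)),
    by simp only [qmul, padd, psc]; ext <;> ring⟩

/-- **The kill relation at the quadratic place.** If `g(A) ≡ (0, 0) (mod m)` coordinate-wise and
`killQ (r₀, r₁, r₂, n) = 0`, then with `Z = z(A)`, `R = r(A)`, `T = (t₁α + t₂α²)(A)`, `w₀ = (z·r²)₀`:
`Z·R² ≡ (w₀, 0) − n²·T (mod m)` coordinate-wise (`pev_zsq` and the two vanishing coordinates of `z·r² + n²θ − w₀`).
[cite: Cassels1991LecturesEllipticCurves, §15] -/
theorem root_rel₂ {m s₁ s₀ a b c : ℤ} {A : ℤ × ℤ} (hG₁ : m ∣ (pg s₁ s₀ a b c A).1)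
    (hG₂ : m ∣ (pg s₁ s₀ a b c A).2) {z : ℤ × ℤ × ℤ} {t₁ t₂ r₀ r₁ r₂ n : ℤ}
    (h0 : killQ a b c z t₁ t₂ (r₀, r₁, r₂, n) = 0) :
    m ∣ (qmul s₁ s₀ (pev s₁ s₀ A z) (qmul s₁ s₀ (pev s₁ s₀ A (r₀, r₁, r₂)) (pev s₁ s₀ A (r₀, r₁, r₂)))).1 -
        ((zsq a b c z (r₀, r₁, r₂)).1 - n ^ 2 * (pev s₁ s₀ A (0, t₁, t₂)).1) ∧
      m ∣ (qmul s₁ s₀ (pev s₁ s₀ A z) (qmul s₁ s₀ (pev s₁ s₀ A (r₀, r₁, r₂)) (pev s₁ s₀ A (r₀, r₁, r₂)))).2 -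
        (0 - n ^ 2 * (pev s₁ s₀ A (0, t₁, t₂)).2) := by
  obtain ⟨κ, hκ⟩ := pev_zsq s₁ s₀ a b c A z (r₀, r₁, r₂)
  obtain ⟨⟨k₁, hk₁⟩, ⟨k₂, hk₂⟩⟩ := dvd_qmul (s₁ := s₁) (s₀ := s₀) κ hG₁ hG₂
  -- the two vanishing coordinates of the kill equation
  have hq₁ : (zsq a b c z (r₀, r₁, r₂)).2.1 + t₁ * n ^ 2 = 0 := by
    have := congrArg Prod.fst h0; simpa [killQ] using this
  have hq₂ : (zsq a b c z (r₀, r₁, r₂)).2.2 + t₂ * n ^ 2 = 0 := by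
    have := congrArg Prod.snd h0; simpa [killQ] using this
  -- coordinates of `pev (zsq …)` read two ways
  have e₁ := congrArg Prod.fst hκ
  have e₂ := congrArg Prod.snd hκ
  simp only [pev, padd, psc] at e₁ e₂
  -- `e₁ : w₀ + w₁·A.1 + w₂·(A²).1 = main.1 + (κ·G).1`, similarly `e₂`
  refine ⟨⟨-k₁, ?_⟩, ⟨-k₂, ?_⟩⟩
  · simp only [pev, padd, psc]
    linear_combination (-1 : ℤ) * e₁ + A.1 * hq₁ + (qmul s₁ s₀ A A).1 * hq₂ - hk₁
  · simp only [pev, padd, psc]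
    linear_combination (-1 : ℤ) * e₂ + A.2 * hq₁ + (qmul s₁ s₀ A A).2 * hq₂ - hk₂

/-! ### Unit square classes mod `8·O_w` and the core lemma at an UNRAMIFIED quadratic place -/

/-- `x` is a square modulo `8` coordinate-wise: some `t ∈ (ℤ/8)²` has `t² ≡ x (mod 8)`. [folklore] -/
def isSq8 (s₁ s₀ : ℤ) (x : ℤ × ℤ) : Bool :=
  ((List.range 8).product (List.range 8)).any fun t =>
    ((qmul s₁ s₀ ((t.1 : ℤ), (t.2 : ℤ)) ((t.1 : ℤ), (t.2 : ℤ))).1 - x.1) % 8 == 0 &&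
      ((qmul s₁ s₀ ((t.1 : ℤ), (t.2 : ℤ)) ((t.1 : ℤ), (t.2 : ℤ))).2 - x.2) % 8 == 0

/-- `qmul` respects congruences coordinate-wise. [folklore] -/
theorem qmul_modEq {m s₁ s₀ : ℤ} {x x' y y' : ℤ × ℤ} (h₁ : x.1 ≡ x'.1 [ZMOD m]) (h₂ : x.2 ≡ x'.2 [ZMOD m])
    (h₃ : y.1 ≡ y'.1 [ZMOD m]) (h₄ : y.2 ≡ y'.2 [ZMOD m]) :
    (qmul s₁ s₀ x y).1 ≡ (qmul s₁ s₀ x' y').1 [ZMOD m] ∧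
      (qmul s₁ s₀ x y).2 ≡ (qmul s₁ s₀ x' y').2 [ZMOD m] := by
  simp only [qmul]
  exact ⟨(h₁.mul h₃).add ((h₂.mul h₄).mul_right _),
    ((h₁.mul h₄).add (h₂.mul h₃)).add ((h₂.mul h₄).mul_right _)⟩

/-- A witness `t` with `t² ≡ x (mod 8)` makes `isSq8 x = true`. [folklore] -/
theorem isSq8_of_witness {s₁ s₀ : ℤ} {x : ℤ × ℤ} (t : ℤ × ℤ) (h₁ : (8 : ℤ) ∣ (qmul s₁ s₀ t t).1 - x.1)
    (h₂ : (8 : ℤ) ∣ (qmul s₁ s₀ t t).2 - x.2) : isSq8 s₁ s₀ x = true := by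
  unfold isSq8
  rw [List.any_eq_true]
  refine ⟨((t.1 % 8).toNat, (t.2 % 8).toNat), ?_, ?_⟩
  · simp only [List.pair_mem_product, List.mem_range]; omega
  · have e₁ : (((t.1 % 8).toNat : ℕ) : ℤ) = t.1 % 8 := by omega
    have e₂ : (((t.2 % 8).toNat : ℕ) : ℤ) = t.2 % 8 := by omega
    simp only [e₁, e₂]
    have c₁ : t.1 % 8 ≡ t.1 [ZMOD 8] := Int.mod_modEq _ _
    have c₂ : t.2 % 8 ≡ t.2 [ZMOD 8] := Int.mod_modEq _ _
    obtain ⟨m₁, m₂⟩ := qmul_modEq (s₁ := s₁) (s₀ := s₀) (x := (t.1 % 8, t.2 % 8)) (x' := t)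
      (y := (t.1 % 8, t.2 % 8)) (y' := t) c₁ c₂ c₁ c₂
    have d₁ := Int.modEq_iff_dvd.mp m₁.symm
    have d₂ := Int.modEq_iff_dvd.mp m₂.symm
    have g₁ : (8 : ℤ) ∣ (qmul s₁ s₀ (t.1 % 8, t.2 % 8) (t.1 % 8, t.2 % 8)).1 - x.1 := by
      have := dvd_add d₁ h₁; rwa [sub_add_sub_cancel] at this
    have g₂ : (8 : ℤ) ∣ (qmul s₁ s₀ (t.1 % 8, t.2 % 8) (t.1 % 8, t.2 % 8)).2 - x.2 := by
      have := dvd_add d₂ h₂; rwa [sub_add_sub_cancel] at this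
    simp only [Bool.and_eq_true, beq_iff_eq]
    exact ⟨Int.emod_eq_zero_of_dvd g₁, Int.emod_eq_zero_of_dvd g₂⟩

/-- `F₄ = 𝔽₂[w]/(w² + w + 1)` is a domain: at an unramified place (`s₀, s₁` odd) the product of two pairs with
an odd coordinate has an odd coordinate. [folklore] -/
theorem unr_domain {s₁ s₀ : ℤ} (hs₁ : ¬ (2 : ℤ) ∣ s₁) (hs₀ : ¬ (2 : ℤ) ∣ s₀) {x y : ℤ × ℤ}
    (hx : ¬ ((2 : ℤ) ∣ x.1 ∧ (2 : ℤ) ∣ x.2)) (hy : ¬ ((2 : ℤ) ∣ y.1 ∧ (2 : ℤ) ∣ y.2)) :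
    ¬ ((2 : ℤ) ∣ (qmul s₁ s₀ x y).1 ∧ (2 : ℤ) ∣ (qmul s₁ s₀ x y).2) := by
  simp only [qmul, ← even_iff_two_dvd, Int.even_add, Int.even_mul] at *
  tauto

/-- Cancel `2^k`: `2^(N'+k) ∣ 2^k·a` gives `2^N' ∣ a`. [folklore] -/
theorem pow_dvd_cancel {k N' : ℕ} {a : ℤ} (h : (2 : ℤ) ^ (N' + k) ∣ (2 : ℤ) ^ k * a) :
    (2 : ℤ) ^ N' ∣ a := by
  rw [pow_add, mul_comm] at h
  exact (mul_dvd_mul_iff_left (pow_ne_zero k (by norm_num : (2 : ℤ) ≠ 0))).mp h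

/-- **Core lemma at an unramified quadratic place.** `2^N ∣ 2^s·Z·R² − 2^j·W` coordinate-wise on `{1, w}`
with `Z`, `W` primitive (an odd coordinate each) and `j + 2 < N` forces `s + j` even and `Z·W` a square mod `8`
(so `W` lies in the square class of `Z`). Induction on `j` as `core8`, the domain `F₄` replacing "odd·odd is
odd". [folklore] -/
theorem coreU {s₁ s₀ : ℤ} (hs₁ : ¬ (2 : ℤ) ∣ s₁) (hs₀ : ¬ (2 : ℤ) ∣ s₀) {Z W : ℤ × ℤ}
    (hZ : ¬ ((2 : ℤ) ∣ Z.1 ∧ (2 : ℤ) ∣ Z.2)) (hW : ¬ ((2 : ℤ) ∣ W.1 ∧ (2 : ℤ) ∣ W.2)) (j : ℕ) :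
    ∀ (s N : ℕ) (R : ℤ × ℤ), j + 2 < N →
      (2 : ℤ) ^ N ∣ (2 : ℤ) ^ s * (qmul s₁ s₀ Z (qmul s₁ s₀ R R)).1 - (2 : ℤ) ^ j * W.1 →
      (2 : ℤ) ^ N ∣ (2 : ℤ) ^ s * (qmul s₁ s₀ Z (qmul s₁ s₀ R R)).2 - (2 : ℤ) ^ j * W.2 →
      (s + j) % 2 = 0 ∧ isSq8 s₁ s₀ (qmul s₁ s₀ Z W) = true := by
  induction' j using Nat.strong_induction_on with j ih
  rintro s N ⟨R₁, R₂⟩ hjN h₁ h₂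
  have hq0 : (2 : ℤ) ≠ 0 := by norm_num
  have hqN : (2 : ℤ) ∣ (2 : ℤ) ^ N := dvd_pow_self _ (by omega)
  cases j with
  | zero =>
    cases s with
    | zero =>
      refine ⟨by simp, ?_⟩
      obtain ⟨N', rfl⟩ : ∃ N', N = N' + 3 := ⟨N - 3, by omega⟩
      have h8 : (8 : ℤ) ∣ (2 : ℤ) ^ (N' + 3) := ⟨(2 : ℤ) ^ N', by ring⟩
      have g₁ : (8 : ℤ) ∣ (qmul s₁ s₀ Z (qmul s₁ s₀ (R₁, R₂) (R₁, R₂))).1 - W.1 := by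
        simpa using h8.trans h₁
      have g₂ : (8 : ℤ) ∣ (qmul s₁ s₀ Z (qmul s₁ s₀ (R₁, R₂) (R₁, R₂))).2 - W.2 := by
        simpa using h8.trans h₂
      -- witness `t = Z·R`: `t² − Z·W = Z·(Z·R² − W)`
      refine isSq8_of_witness (qmul s₁ s₀ Z (R₁, R₂)) ?_ ?_
      · have e : (qmul s₁ s₀ (qmul s₁ s₀ Z (R₁, R₂)) (qmul s₁ s₀ Z (R₁, R₂))).1 - (qmul s₁ s₀ Z W).1 =
            Z.1 * ((qmul s₁ s₀ Z (qmul s₁ s₀ (R₁, R₂) (R₁, R₂))).1 - W.1) +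
              Z.2 * ((qmul s₁ s₀ Z (qmul s₁ s₀ (R₁, R₂) (R₁, R₂))).2 - W.2) * s₀ := by
          simp only [qmul]; ring
        rw [e]
        exact dvd_add (dvd_mul_of_dvd_right g₁ _) (dvd_mul_of_dvd_left (dvd_mul_of_dvd_right g₂ _) _)
      · have e : (qmul s₁ s₀ (qmul s₁ s₀ Z (R₁, R₂)) (qmul s₁ s₀ Z (R₁, R₂))).2 - (qmul s₁ s₀ Z W).2 =
            Z.1 * ((qmul s₁ s₀ Z (qmul s₁ s₀ (R₁, R₂) (R₁, R₂))).2 - W.2) +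
              Z.2 * ((qmul s₁ s₀ Z (qmul s₁ s₀ (R₁, R₂) (R₁, R₂))).1 - W.1) +
              Z.2 * ((qmul s₁ s₀ Z (qmul s₁ s₀ (R₁, R₂) (R₁, R₂))).2 - W.2) * s₁ := by
          simp only [qmul]; ring
        rw [e]
        exact dvd_add (dvd_add (dvd_mul_of_dvd_right g₂ _) (dvd_mul_of_dvd_right g₁ _))
          (dvd_mul_of_dvd_left (dvd_mul_of_dvd_right g₂ _) _)
    | succ s =>
      exfalso
      apply hW
      have h2 : ∀ X : ℤ, (2 : ℤ) ∣ (2 : ℤ) ^ (s + 1) * X := fun X =>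
        dvd_mul_of_dvd_left (dvd_pow_self _ (Nat.succ_ne_zero s)) X
      constructor
      · have := dvd_sub (h2 (qmul s₁ s₀ Z (qmul s₁ s₀ (R₁, R₂) (R₁, R₂))).1) (hqN.trans h₁); simpa using this
      · have := dvd_sub (h2 (qmul s₁ s₀ Z (qmul s₁ s₀ (R₁, R₂) (R₁, R₂))).2) (hqN.trans h₂); simpa using this
  | succ j =>
    cases s with
    | succ s =>
      obtain ⟨N', rfl⟩ : ∃ N', N = N' + 1 := ⟨N - 1, by omega⟩
      have d₁ : (2 : ℤ) ^ N' ∣ (2 : ℤ) ^ s * (qmul s₁ s₀ Z (qmul s₁ s₀ (R₁, R₂) (R₁, R₂))).1 - (2 : ℤ) ^ j * W.1 := by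
        refine pow_dvd_cancel (k := 1) ?_
        have e : (2 : ℤ) ^ 1 * ((2 : ℤ) ^ s * (qmul s₁ s₀ Z (qmul s₁ s₀ (R₁, R₂) (R₁, R₂))).1 - (2 : ℤ) ^ j * W.1) =
            (2 : ℤ) ^ (s + 1) * (qmul s₁ s₀ Z (qmul s₁ s₀ (R₁, R₂) (R₁, R₂))).1 - (2 : ℤ) ^ (j + 1) * W.1 := by ring
        rw [e]; exact h₁
      have d₂ : (2 : ℤ) ^ N' ∣ (2 : ℤ) ^ s * (qmul s₁ s₀ Z (qmul s₁ s₀ (R₁, R₂) (R₁, R₂))).2 - (2 : ℤ) ^ j * W.2 := by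
        refine pow_dvd_cancel (k := 1) ?_
        have e : (2 : ℤ) ^ 1 * ((2 : ℤ) ^ s * (qmul s₁ s₀ Z (qmul s₁ s₀ (R₁, R₂) (R₁, R₂))).2 - (2 : ℤ) ^ j * W.2) =
            (2 : ℤ) ^ (s + 1) * (qmul s₁ s₀ Z (qmul s₁ s₀ (R₁, R₂) (R₁, R₂))).2 - (2 : ℤ) ^ (j + 1) * W.2 := by ring
        rw [e]; exact h₂
      have := ih j (by omega) s N' (R₁, R₂) (by omega) d₁ d₂
      exact ⟨by omega, this.2⟩
    | zero =>
      -- `Z·R²` has both coordinates even, hence so does `R` (domain `F₄`, twice)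
      have hj2 : ∀ X : ℤ, (2 : ℤ) ∣ (2 : ℤ) ^ (j + 1) * X := fun X =>
        dvd_mul_of_dvd_left (dvd_pow_self _ (Nat.succ_ne_zero j)) X
      have hX₁ : (2 : ℤ) ∣ (qmul s₁ s₀ Z (qmul s₁ s₀ (R₁, R₂) (R₁, R₂))).1 := by
        have := dvd_add (hqN.trans h₁) (hj2 W.1); simpa using this
      have hX₂ : (2 : ℤ) ∣ (qmul s₁ s₀ Z (qmul s₁ s₀ (R₁, R₂) (R₁, R₂))).2 := by
        have := dvd_add (hqN.trans h₂) (hj2 W.2); simpa using this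
      have hR : (2 : ℤ) ∣ R₁ ∧ (2 : ℤ) ∣ R₂ := by
        by_contra hR
        have hR' : ¬ ((2 : ℤ) ∣ (R₁, R₂).1 ∧ (2 : ℤ) ∣ (R₁, R₂).2) := by simpa using hR
        exact unr_domain hs₁ hs₀ hZ (unr_domain hs₁ hs₀ hR' hR') ⟨hX₁, hX₂⟩
      obtain ⟨⟨ρ₁, rfl⟩, ⟨ρ₂, rfl⟩⟩ := hR
      have e₁ : (qmul s₁ s₀ Z (qmul s₁ s₀ (2 * ρ₁, 2 * ρ₂) (2 * ρ₁, 2 * ρ₂))).1 =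
          4 * (qmul s₁ s₀ Z (qmul s₁ s₀ (ρ₁, ρ₂) (ρ₁, ρ₂))).1 := by simp only [qmul]; ring
      have e₂ : (qmul s₁ s₀ Z (qmul s₁ s₀ (2 * ρ₁, 2 * ρ₂) (2 * ρ₁, 2 * ρ₂))).2 =
          4 * (qmul s₁ s₀ Z (qmul s₁ s₀ (ρ₁, ρ₂) (ρ₁, ρ₂))).2 := by simp only [qmul]; ring
      rw [e₁] at h₁
      rw [e₂] at h₂
      cases j with
      | zero =>
        exfalso
        apply hW
        obtain ⟨N', rfl⟩ : ∃ N', N = N' + 2 := ⟨N - 2, by omega⟩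
        have h4 : (2 : ℤ) * 2 ∣ (2 : ℤ) ^ (N' + 2) := ⟨(2 : ℤ) ^ N', by ring⟩
        constructor
        · have hA := h4.trans h₁
          have hB : (2 : ℤ) * 2 ∣ (2 : ℤ) * W.1 := by
            have e : (2 : ℤ) * W.1 = (2 : ℤ) * 2 * (qmul s₁ s₀ Z (qmul s₁ s₀ (ρ₁, ρ₂) (ρ₁, ρ₂))).1 -
                ((2 : ℤ) ^ 0 * (4 * (qmul s₁ s₀ Z (qmul s₁ s₀ (ρ₁, ρ₂) (ρ₁, ρ₂))).1) - (2 : ℤ) ^ (0 + 1) * W.1) := by ring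
            rw [e]; exact dvd_sub (dvd_mul_right _ _) hA
          exact (mul_dvd_mul_iff_left hq0).mp hB
        · have hA := h4.trans h₂
          have hB : (2 : ℤ) * 2 ∣ (2 : ℤ) * W.2 := by
            have e : (2 : ℤ) * W.2 = (2 : ℤ) * 2 * (qmul s₁ s₀ Z (qmul s₁ s₀ (ρ₁, ρ₂) (ρ₁, ρ₂))).2 -
                ((2 : ℤ) ^ 0 * (4 * (qmul s₁ s₀ Z (qmul s₁ s₀ (ρ₁, ρ₂) (ρ₁, ρ₂))).2) - (2 : ℤ) ^ (0 + 1) * W.2) := by ring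
            rw [e]; exact dvd_sub (dvd_mul_right _ _) hA
          exact (mul_dvd_mul_iff_left hq0).mp hB
      | succ j =>
        obtain ⟨N', rfl⟩ : ∃ N', N = N' + 2 := ⟨N - 2, by omega⟩
        have d₁ : (2 : ℤ) ^ N' ∣ (2 : ℤ) ^ 0 * (qmul s₁ s₀ Z (qmul s₁ s₀ (ρ₁, ρ₂) (ρ₁, ρ₂))).1 - (2 : ℤ) ^ j * W.1 := by
          refine pow_dvd_cancel (k := 2) ?_
          have e : (2 : ℤ) ^ 2 * ((2 : ℤ) ^ 0 * (qmul s₁ s₀ Z (qmul s₁ s₀ (ρ₁, ρ₂) (ρ₁, ρ₂))).1 - (2 : ℤ) ^ j * W.1) =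
              (2 : ℤ) ^ 0 * (4 * (qmul s₁ s₀ Z (qmul s₁ s₀ (ρ₁, ρ₂) (ρ₁, ρ₂))).1) - (2 : ℤ) ^ (j + 1 + 1) * W.1 := by ring
          rw [e]; exact h₁
        have d₂ : (2 : ℤ) ^ N' ∣ (2 : ℤ) ^ 0 * (qmul s₁ s₀ Z (qmul s₁ s₀ (ρ₁, ρ₂) (ρ₁, ρ₂))).2 - (2 : ℤ) ^ j * W.2 := by
          refine pow_dvd_cancel (k := 2) ?_
          have e : (2 : ℤ) ^ 2 * ((2 : ℤ) ^ 0 * (qmul s₁ s₀ Z (qmul s₁ s₀ (ρ₁, ρ₂) (ρ₁, ρ₂))).2 - (2 : ℤ) ^ j * W.2) =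
              (2 : ℤ) ^ 0 * (4 * (qmul s₁ s₀ Z (qmul s₁ s₀ (ρ₁, ρ₂) (ρ₁, ρ₂))).2) - (2 : ℤ) ^ (j + 1 + 1) * W.2 := by ring
          rw [e]; exact h₂
        have := ih j (by omega) 0 N' (ρ₁, ρ₂) (by omega) d₁ d₂
        exact ⟨by omega, this.2⟩

/-! ### The quadratic leaf of the disc walk (unramified place) -/

/-- `psplit fuel x = (m, x')` with `x = 2^m • x'` coordinate-wise; `x'` has an odd coordinate as soon as
`x ≠ 0` and `fuel ≥ m` — the checker tests that itself (`splitPow` for pairs). [folklore] -/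
def psplit : ℕ → ℤ × ℤ → ℕ × (ℤ × ℤ)
  | 0, x => (0, x)
  | f + 1, x =>
      if (x.1 ≠ 0 ∨ x.2 ≠ 0) ∧ x.1 % 2 = 0 ∧ x.2 % 2 = 0 then
        ((psplit f (x.1 / 2, x.2 / 2)).1 + 1, (psplit f (x.1 / 2, x.2 / 2)).2)
      else (0, x)

/-- `x = 2^m • x'` for `(m, x') = psplit fuel x`. [folklore] -/
theorem psplit_spec : ∀ (f : ℕ) (x : ℤ × ℤ),
    x.1 = (2 : ℤ) ^ (psplit f x).1 * (psplit f x).2.1 ∧ x.2 = (2 : ℤ) ^ (psplit f x).1 * (psplit f x).2.2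
  | 0, x => by simp [psplit]
  | f + 1, x => by
      by_cases h : (x.1 ≠ 0 ∨ x.2 ≠ 0) ∧ x.1 % 2 = 0 ∧ x.2 % 2 = 0
      · rw [psplit, if_pos h]
        obtain ⟨ih₁, ih₂⟩ := psplit_spec f (x.1 / 2, x.2 / 2)
        have hx₁ : (2 : ℤ) * (x.1 / 2) = x.1 := Int.mul_ediv_cancel' (Int.dvd_of_emod_eq_zero h.2.1)
        have hx₂ : (2 : ℤ) * (x.2 / 2) = x.2 := Int.mul_ediv_cancel' (Int.dvd_of_emod_eq_zero h.2.2)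
        simp only at ih₁ ih₂
        constructor
        · calc x.1 = (2 : ℤ) * (x.1 / 2) := hx₁.symm
            _ = (2 : ℤ) * ((2 : ℤ) ^ (psplit f (x.1 / 2, x.2 / 2)).1 * (psplit f (x.1 / 2, x.2 / 2)).2.1) := by
                rw [← ih₁]
            _ = _ := by rw [pow_succ]; ring
        · calc x.2 = (2 : ℤ) * (x.2 / 2) := hx₂.symm
            _ = (2 : ℤ) * ((2 : ℤ) ^ (psplit f (x.1 / 2, x.2 / 2)).1 * (psplit f (x.1 / 2, x.2 / 2)).2.2) := by
                rw [← ih₂]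
            _ = _ := by rw [pow_succ]; ring
      · rw [psplit, if_neg h]; simp

/-- `isSq8` only depends on `x mod 8`. [folklore] -/
theorem isSq8_congr {s₁ s₀ : ℤ} {x x' : ℤ × ℤ} (h₁ : x.1 ≡ x'.1 [ZMOD 8]) (h₂ : x.2 ≡ x'.2 [ZMOD 8]) :
    isSq8 s₁ s₀ x = isSq8 s₁ s₀ x' := by
  have e₁ : ∀ P : ℤ, (P - x.1) % 8 = (P - x'.1) % 8 := fun P => (Int.ModEq.refl P).sub h₁
  have e₂ : ∀ P : ℤ, (P - x.2) % 8 = (P - x'.2) % 8 := fun P => (Int.ModEq.refl P).sub h₂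
  simp only [isSq8, e₁, e₂]

/-- MISMATCH AT THE UNRAMIFIED QUADRATIC PLACE outside/inside the disc `y ≡ c (mod 2^j)`: with
`(c − p, −q) = 2^m₀ • δ'` (`psplit`), `δ'` primitive and `m₀ + 3 ≤ j`, the class of `y − A` on the disc is that of
`2^m₀ • δ'`; mismatch = the quadratic root datum `(s, Z')` of `z` has the other parity, or `Z'·δ'` is not a
square mod `8`. [cite: CremonaAlgorithms1997, §3.6] -/
def outMisU (s₁ s₀ : ℤ) (c : ℤ) (j : ℕ) (ζ : ℕ × (ℤ × ℤ)) (A : ℤ × ℤ) : Bool :=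
  let sp := psplit j (c - A.1, -A.2)
  let δ' := sp.2
  !decide (δ'.1 % 2 = 0 ∧ δ'.2 % 2 = 0) && decide (sp.1 + 3 ≤ j) &&
    (!decide ((ζ.1 + sp.1) % 2 = 0) || !isSq8 s₁ s₀ (qmul s₁ s₀ ζ.2 δ'))

/-- Soundness of `outMisU`: no `y ≡ c (mod 2^j)` satisfies the kill relation
`2^N ∣ 2^s·Z'·R² − 2^K·(y − A)` at the unramified place (`K` even, `K ≤ B`, `j + B + 2 < N`).
[cite: CremonaAlgorithms1997, §3.6] -/
theorem outMisU_sound {s₁ s₀ : ℤ} (hs₁ : ¬ (2 : ℤ) ∣ s₁) (hs₀ : ¬ (2 : ℤ) ∣ s₀) {c : ℤ} {j s : ℕ}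
    {Z' A : ℤ × ℤ} (hZ : ¬ ((2 : ℤ) ∣ Z'.1 ∧ (2 : ℤ) ∣ Z'.2))
    (h : outMisU s₁ s₀ c j (s, Z') A = true) {B N K : ℕ} (hK : K ≤ B) (hK2 : K % 2 = 0)
    (hj : j + B + 2 < N) {y : ℤ} (hy : (2 : ℤ) ^ j ∣ y - c)
    (hX : ∃ R : ℤ × ℤ,
      (2 : ℤ) ^ N ∣ (2 : ℤ) ^ s * (qmul s₁ s₀ Z' (qmul s₁ s₀ R R)).1 - (2 : ℤ) ^ K * (y - A.1) ∧
        (2 : ℤ) ^ N ∣ (2 : ℤ) ^ s * (qmul s₁ s₀ Z' (qmul s₁ s₀ R R)).2 - (2 : ℤ) ^ K * (-A.2)) : False := by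
  obtain ⟨R, hR₁, hR₂⟩ := hX
  simp only [outMisU, Bool.and_eq_true, Bool.or_eq_true, Bool.not_eq_true', decide_eq_true_eq,
    decide_eq_false_iff_not] at h
  obtain ⟨⟨hprim, hm⟩, hmis⟩ := h
  obtain ⟨sp₁, sp₂⟩ := psplit_spec j (c - A.1, -A.2)
  set m₀ := (psplit j (c - A.1, -A.2)).1 with hm₀
  set δ' := (psplit j (c - A.1, -A.2)).2 with hδ'
  simp only at sp₁ sp₂
  obtain ⟨t, ht⟩ := hy
  obtain ⟨d, hd⟩ : ∃ d, j = m₀ + 3 + d := ⟨j - (m₀ + 3), by omega⟩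
  -- on the disc: `y − A = 2^m₀ • δ''` with `δ'' ≡ δ' (mod 8)`
  set δ'' : ℤ × ℤ := (δ'.1 + (2 : ℤ) ^ (3 + d) * t, δ'.2) with hδ''
  have ey₁ : y - A.1 = (2 : ℤ) ^ m₀ * δ''.1 := by
    have : y - A.1 = (c - A.1) + (y - c) := by ring
    rw [this, sp₁, ht, hd, hδ'']; ring
  have ey₂ : -A.2 = (2 : ℤ) ^ m₀ * δ''.2 := by rw [hδ'']; exact sp₂
  have hprim'' : ¬ ((2 : ℤ) ∣ δ''.1 ∧ (2 : ℤ) ∣ δ''.2) := by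
    rintro ⟨h1, h2⟩
    apply hprim
    have h1' : (2 : ℤ) ∣ δ'.1 := by
      have e : δ'.1 = δ''.1 - 2 * ((2 : ℤ) ^ (2 + d) * t) := by rw [hδ'']; ring
      rw [e]; exact dvd_sub h1 (dvd_mul_right _ _)
    have h2' : (2 : ℤ) ∣ δ'.2 := by simpa [hδ''] using h2
    exact ⟨Int.emod_eq_zero_of_dvd h1', Int.emod_eq_zero_of_dvd h2'⟩
  have r₁ : (2 : ℤ) ^ N ∣ (2 : ℤ) ^ s * (qmul s₁ s₀ Z' (qmul s₁ s₀ R R)).1 - (2 : ℤ) ^ (K + m₀) * δ''.1 := by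
    have e : (2 : ℤ) ^ (K + m₀) * δ''.1 = (2 : ℤ) ^ K * (y - A.1) := by rw [ey₁, pow_add]; ring
    rw [e]; exact hR₁
  have r₂ : (2 : ℤ) ^ N ∣ (2 : ℤ) ^ s * (qmul s₁ s₀ Z' (qmul s₁ s₀ R R)).2 - (2 : ℤ) ^ (K + m₀) * δ''.2 := by
    have e : (2 : ℤ) ^ (K + m₀) * δ''.2 = (2 : ℤ) ^ K * (-A.2) := by rw [ey₂, pow_add]; ring
    rw [e]; exact hR₂
  obtain ⟨hpar, hsq⟩ := coreU hs₁ hs₀ hZ hprim'' (K + m₀) s N R (by omega) r₁ r₂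
  rcases hmis with hmis | hmis
  · exact hmis (by omega)
  · have c₁ : δ''.1 ≡ δ'.1 [ZMOD 8] := by
      apply Int.modEq_iff_dvd.mpr
      refine ⟨-((2 : ℤ) ^ d * t), ?_⟩
      rw [hδ'']; ring
    have c₂ : δ''.2 ≡ δ'.2 [ZMOD 8] := by rw [hδ'']
    obtain ⟨p₁, p₂⟩ := qmul_modEq (s₁ := s₁) (s₀ := s₀) (Int.ModEq.refl Z'.1) (Int.ModEq.refl Z'.2) c₁ c₂
    rw [isSq8_congr p₁ p₂] at hsq
    rw [hsq] at hmis
    exact Bool.noConfusion hmis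
end Summit.BirchSwinnertonDyer.BirchSwinnertonDyer.Rank2Observatory.TwoDescKill
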